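import Summits.RiemannHypothesis.RiemannHypothesis.Theses.WeilParity
import Literature.NumberTheory.LFunctions.WeilOddGroundState
import Literature.NumberTheory.LFunctions.WeilSmallSupportPositivity

/-!
# `EvenWinsArch` (crux stmt-RiemannHypothesis-15433, route WeilParity) — load-bearing analysis:
# the window constraint on the odd competitor

Negative lemma from the standing disprover (refuter-cdisprove-stmt-RiemannHypothesis-15433-0, cycle 1).
The crux itself is a THEOREM (`Theorems.WeilParity.evenWinsArch_proof`, p151491); this file records
that its hypothesis `tsupport o ⊆ Set.Icc (-a) a` cannot be dropped: the variant in which the odd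
normalised competitor `o` may live on ANY window (while the even partner must live on `[-a, a]`) is
FALSE. Mechanism: coercivity of Weil's functional for small support (`weilQuadratic_coercive`,
Bombieri 2000 Thm 12: `Re Q(e) ≥ A ‖e‖²` on `[-a, a]` for `a ≤ a₀(A)`) against the fixed energy of one
odd test on `[-1, 1]`. The statement is inlined (no new definition); it is the crux's signature with
exactly that one hypothesis deleted. Companion (normalisation `∫ ‖o‖² = 1` load-bearing): p151136.

Axioms: propext, Classical.choice, Quot.sound.
-/

noncomputable section

namespace Summit.RiemannHypothesis.RiemannHypothesis.Theorems.WeilParity.EvenWinsArch.Negative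

-- `Summit.RiemannHypothesis.RiemannHypothesis.…` repeats a namespace component by design (D-0017 layout).
set_option linter.dupNamespace false

open Set MeasureTheory
open Literature.NumberTheory.LFunctions

/-- **The window constraint on the odd competitor is load-bearing in `EvenWinsArch`.** The crux with
the hypothesis `tsupport o ⊆ Set.Icc (-a) a` deleted is false: fix an odd normalised test `o₀` on
`[-1, 1]` (`exists_isWeilTest_odd_sphere`) with energy `q₀ = Re Q(o₀)`; coercivity
(`weilQuadratic_coercive (q₀ + 1)`) gives `a₀ > 0` with `Re Q(e) ≥ q₀ + 1` for every normalised test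
`e` on `[-a, a]`, `0 < a ≤ a₀`; at the window `a = min a₀ ((log 2)/2)` and `δ = 1/2` no even partner
exists. [folklore] -/
theorem evenWinsArch_false_without_support :
    ¬ (∀ a : ℝ, 0 < a → a ≤ Real.log 2 / 2 → ∀ o : ℝ → ℂ, IsWeilTest o → (∀ t, o (-t) = -o t) →
        ∫ t, ‖o t‖ ^ 2 = (1 : ℝ) → ∀ δ : ℝ, 0 < δ → ∃ e : ℝ → ℂ, IsWeilTest e ∧
          tsupport e ⊆ Set.Icc (-a) a ∧ (∀ t, e (-t) = e t) ∧ ∫ t, ‖e t‖ ^ 2 = (1 : ℝ) ∧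
          (weilQuadratic e).re ≤ (weilQuadratic o).re + δ) := by
  intro h
  obtain ⟨o, ho, -, hodd, hon⟩ := exists_isWeilTest_odd_sphere one_pos
  obtain ⟨a₀, ha₀, hco⟩ := weilQuadratic_coercive ((weilQuadratic o).re + 1)
  have hlog : 0 < Real.log 2 / 2 := by
    have := Real.log_two_gt_d9
    linarith
  have ha : 0 < min a₀ (Real.log 2 / 2) := lt_min ha₀ hlog
  obtain ⟨e, he, hes, -, hen, hle⟩ :=
    h (min a₀ (Real.log 2 / 2)) ha (min_le_right _ _) o ho hodd hon (1 / 2) (by norm_num)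
  have h1 := hco _ ha (min_le_left _ _) e he hes
  rw [hen, mul_one] at h1
  linarith

/-- The same fact phrased against the crux's own shape: `EvenWinsArch` does NOT extend to odd
competitors on a larger window — there are windows `0 < a ≤ (log 2)/2`, an odd normalised Weil test
`o` (supported in `[-1, 1]`) and a slack `δ > 0` such that NO even normalised test on `[-a, a]` has
`Re Q(e) ≤ Re Q(o) + δ`. [folklore] -/
theorem exists_odd_unmatched_on_small_window :
    ∃ a : ℝ, 0 < a ∧ a ≤ Real.log 2 / 2 ∧ ∃ o : ℝ → ℂ, IsWeilTest o ∧ tsupport o ⊆ Set.Icc (-1) 1 ∧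
      (∀ t, o (-t) = -o t) ∧ ∫ t, ‖o t‖ ^ 2 = (1 : ℝ) ∧ ∃ δ : ℝ, 0 < δ ∧
      ∀ e : ℝ → ℂ, IsWeilTest e → tsupport e ⊆ Set.Icc (-a) a → (∀ t, e (-t) = e t) →
        ∫ t, ‖e t‖ ^ 2 = (1 : ℝ) → (weilQuadratic o).re + δ < (weilQuadratic e).re := by
  obtain ⟨o, ho, hos, hodd, hon⟩ := exists_isWeilTest_odd_sphere one_pos
  obtain ⟨a₀, ha₀, hco⟩ := weilQuadratic_coercive ((weilQuadratic o).re + 1)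
  have hlog : 0 < Real.log 2 / 2 := by
    have := Real.log_two_gt_d9
    linarith
  have ha : 0 < min a₀ (Real.log 2 / 2) := lt_min ha₀ hlog
  refine ⟨min a₀ (Real.log 2 / 2), ha, min_le_right _ _, o, ho, hos, hodd, hon, 1 / 2, by norm_num,
    fun e he hes _ hen ↦ ?_⟩
  have h1 := hco _ ha (min_le_left _ _) e he hes
  rw [hen, mul_one] at h1
  linarith

end Summit.RiemannHypothesis.RiemannHypothesis.Theorems.WeilParity.EvenWinsArch.Negative

end
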